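/-
Copyright (c) 2026. All rights reserved.
Released under Apache 2.0 license as described in the file LICENSE.
Authors: abc-iut cell, prover seat abc-iut-w5-d038 (gen 8; row «ARC-MTC-F3» (L4-lead m134), part F3b‴: the archimedean
`η⊢_{v,ν}` of [AbsTopIII] Cor 5.10 (iv)(c) is natural UP TO THE SIGN AUTOMORPHISMS of `k∼(G)`, `k×(G)` — i.e. natural in
print's ORBI-categories `Orb(−)` (§0 p. 28; Def 5.6 (iv) p. 136: `𝒩⊢⊞_w := Orb(𝒞^{hol⊢}_{TB⊞}) ×_{Orb(TM⊢),w} Th⊢[Z]`) — with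
NO orientation hypothesis, for EVERY Aut-holomorphic field functor).
-/
import Literature.AnabelianGeometry.AbsoluteAnabelian.ArchimedeanHolGroupPairsEtaTimes
import HarnessLib

/-!
# The archimedean `η⊢` is natural up to sign — the `Orb(−)` reading of [AbsTopIII] Cor 5.10 (iv)(c)

S. Mochizuki, *Topics in absolute anabelian geometry III*.  PRINT, read on the page (kurims manuscript): §0 p. 28 «we shall
refer to a pair `(S, A)`, where `S ∈ Ob(𝒞)`, and `A ⊆ Aut_𝒞(S)` is a subgroup, as a pre-orbi-object of `𝒞` … A morphism of
pre-orbi-objects `(S₁, A₁) → (S₂, A₂)` is an `A₂`-ORBIT of morphisms `S₁ → S₂` … the category of orbi-objects `Orb(𝒞)`»;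
Def 5.4 (vi) p. 128 «`𝒩⊞_v := Orb(𝒞^hol_{TH⊞}) ×_{Orb(EA),v} Th•[Z]`»; Def 5.6 (iv) p. 136 «`𝒩⊢⊞_w := Orb(𝒞^{hol⊢}_{TB⊞})
×_{Orb(TM⊢),w} Th⊢[Z]`», Def 5.6 (ii) p. 135 «for each `w ∈ W^arc`, `G_w ∈ Ob(Orb(TM⊢))`»; Prop 5.8 (iv)/(v) p. 140
(`k∼(G) = C∼ × C∼`, `k×(G) = C× × C∼`, functorial in `TM⊢`); Cor 5.10 (iv)(c) p. 148 (the natural isomorphism `η⊢_{v,ν}`).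

WHY THIS FILE.  The tree's §5 interface (`LogFrobeniusSetting`: `𝒩⊢⊞_v = TM⊢ × TB⊞`) does NOT coarsify by `Orb(−)`.
In that un-coarsified typing abc-iut-w5-d038 showed: the archimedean `η⊢_{v,ν}` is a natural isomorphism of honest
functors `𝒳 ⥤ TB⊞` EXACTLY under an orientation cochain for the transition signs (`HolTFPair.etaTilde/etaTimes`,
p491679/p491980; necessity `not_exists_cochain_of_sign_endo_eq_neg_one` p487676, `ArchimedeanHolGroupPairsEtaNoGo`):
along an orientation-reversing `φ` the `TB⊞`-leg rescales `B″` by `+1`, `k∼(G_φ)` by `-1`.  The discrepancy is a SIGN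
AUTOMORPHISM `(s, t) ↦ (s, ε_φ t)` of `k∼(G)` (resp. `k×(G)`) — an automorphism in `TB⊞` (`a₁ = 1`, `a₂ = ε_φ`,
`|a₂|·β = β·|a₁|`).  Hence in print's orbi-categories, where morphisms into `(k∼(G), A)` with `A ∋ (1, -1)` are
`A`-ORBITS, the naturality square of `η⊢` commutes with NO hypothesis.  This file proves the un-coarsified content
of that statement, for EVERY Aut-holomorphic field functor `𝔄` (no cochain, no restriction on `EA`):

* `TMMono.exists_kTildeObj_signIso / exists_kTimesObj_signIso` — the sign automorphisms `(1, ε)` of `k∼(G)`, `k×(G)`;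
* ★★ `HolTFPair.etaTilde_naturality_upToSign (φ)` — `λ⊞_pre(φ)^{TB⊞} ≫ η⊢_𝕐 = η⊢_𝕏 ≫ k∼(G_φ) ≫ α_φ` with `α_φ` the sign
  automorphism `(1, ε_φ)` of `k∼(G_𝕐)`, for the cochain-free components `η⊢_𝕏 = (σ_𝕏 Im e_𝕏, σ_𝕏 Re e_𝕏)`;
* ★★ `HolTFPair.etaTimes_naturality_upToSign (φ)` — the same at the vertex `mult`;
* `…_upToSign_of_transitionSign_eq_one` — when `ε_φ = 1` the square commutes on the nose.

So: STRICT naturality ⟺ orientation cochain (tree's typing); ORBI-naturality ALWAYS (print's typing).  PROOF-ONLY (0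
definitions); MODEL-LEVEL; nothing here bears on the disputed [IUTchIII] Cor. 3.12; typed ≠ proved; no side taken.
-/

set_option autoImplicit false

universe v u

open CategoryTheory Complex

namespace Literature.AnabelianGeometry.AbsoluteAnabelian

/-! ## §1. The sign automorphisms `(s, t) ↦ (s, ε t)` of `k∼(G)` and `k×(G)` -/

namespace TMMono

/-- A sign is an involution. [folklore] -/
private theorem real_sign_mul_self {ε : ℝ} (hε : ε = 1 ∨ ε = -1) : ε * ε = 1 := by
  rcases hε with h | h <;> rw [h] <;> norm_num

/-- A sign has absolute value one. [folklore] -/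
private theorem real_sign_abs {ε : ℝ} (hε : ε = 1 ∨ ε = -1) : |ε| = 1 := by
  rcases hε with h | h <;> rw [h] <;> norm_num

/-- `k∼(φ)` rescales `B′` by `σ_φ`. [cite: MochizukiAbsTopIII2015, Prop 5.8 (v) p.140] -/
theorem kTildeMap_a₁ {M₁ M₂ : TMMono.{v}} (ψ : M₁ ⟶ M₂) : (kTildeMap.{v} ψ).a₁ = sign ψ := rfl

/-- `k∼(φ)` rescales `B″` by `σ_φ`. [cite: MochizukiAbsTopIII2015, Prop 5.8 (v) p.140] -/
theorem kTildeMap_a₂ {M₁ M₂ : TMMono.{v}} (ψ : M₁ ⟶ M₂) : (kTildeMap.{v} ψ).a₂ = sign ψ := rfl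

/-- **The sign automorphism `(s, t) ↦ (s, ε t)` of `k∼(G) = C∼ × C∼`** is an automorphism in `TB⊞` with rescalings
`a₁ = 1`, `a₂ = ε` (`|ε|·1 = 1·|1|`: the `Lie±`-indeterminacy of Def 5.6 (i)). [cite: MochizukiAbsTopIII2015, Prop 5.8 (iv) p.140] -/
theorem exists_kTildeObj_signIso (ε : ℝ) (hε : ε = 1 ∨ ε = -1) :
    ∃ α : kTildeObj.{v} ≅ kTildeObj.{v}, α.hom.a₁ = 1 ∧ α.hom.a₂ = ε := by
  have h2 := real_sign_mul_self hε
  let h : TildeCarrier.{v} →ₜ+ TildeCarrier.{v} :=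
    { toFun := fun p => ULift.up (p.down.1, ε * p.down.2)
      map_zero' := congrArg ULift.up (by rw [Prod.mk_eq_zero]; exact ⟨rfl, by simp⟩)
      map_add' := fun p q => congrArg ULift.up (by
        change ((p.down.1 + q.down.1), ε * (p.down.2 + q.down.2)) =
          (p.down.1, ε * p.down.2) + (q.down.1, ε * q.down.2)
        rw [Prod.mk_add_mk, mul_add])
      continuous_toFun := continuous_uliftUp.comp ((continuous_fst.comp continuous_uliftDown).prodMk
        (continuous_const.mul (continuous_snd.comp continuous_uliftDown))) }
  have hh : ∀ p, h (h p) = p := fun p => by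
    change ULift.up ((p.down.1, ε * p.down.2).1, ε * (p.down.1, ε * p.down.2).2) = p
    refine ULift.ext _ _ (Prod.ext rfl ?_)
    change ε * (ε * p.down.2) = p.down.2
    rw [← mul_assoc, h2, one_mul]
  let f : kTildeObj.{v} ⟶ kTildeObj.{v} :=
    { toHom := h
      surjective := fun p => ⟨h p, hh p⟩
      a₁ := 1
      a₂ := ε
      map_c₁ := fun s => by
        change ULift.up (((s, (0 : ℝ)) : ℝ × ℝ).1, ε * ((s, (0 : ℝ)) : ℝ × ℝ).2) = ULift.up (1 * s, (0 : ℝ))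
        rw [mul_zero, one_mul]
      map_c₂ := fun t => by
        change ULift.up ((((0 : ℝ), t) : ℝ × ℝ).1, ε * (((0 : ℝ), t) : ℝ × ℝ).2) = ULift.up ((0 : ℝ), ε * t)
        rfl
      map_β := by
        change |ε| * (1 : ℝ) = 1 * |(1 : ℝ)|
        rw [real_sign_abs hε, abs_one] }
  exact ⟨TBPlus.isoMk f f hh hh, rfl, rfl⟩

/-- **The sign automorphism `(z, t) ↦ (z, ε t)` of `k×(G) = C× × C∼`**, rescalings `a₁ = 1`, `a₂ = ε`.
[cite: MochizukiAbsTopIII2015, Prop 5.8 (iv) p.140] -/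
theorem exists_kTimesObj_signIso (ε : ℝ) (hε : ε = 1 ∨ ε = -1) :
    ∃ α : kTimesObj.{v} ≅ kTimesObj.{v}, α.hom.a₁ = 1 ∧ α.hom.a₂ = ε := by
  have h2 := real_sign_mul_self hε
  let h : TimesCarrier.{v} →ₜ+ TimesCarrier.{v} :=
    { toFun := fun p => ULift.up (p.down.1, ε * p.down.2)
      map_zero' := congrArg ULift.up (by rw [Prod.mk_eq_zero]; exact ⟨rfl, by simp⟩)
      map_add' := fun p q => congrArg ULift.up (by
        change ((p.down.1 + q.down.1), ε * (p.down.2 + q.down.2)) =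
          (p.down.1, ε * p.down.2) + (q.down.1, ε * q.down.2)
        rw [Prod.mk_add_mk, mul_add])
      continuous_toFun := continuous_uliftUp.comp ((continuous_fst.comp continuous_uliftDown).prodMk
        (continuous_const.mul (continuous_snd.comp continuous_uliftDown))) }
  have hh : ∀ p, h (h p) = p := fun p => by
    change ULift.up ((p.down.1, ε * p.down.2).1, ε * (p.down.1, ε * p.down.2).2) = p
    refine ULift.ext _ _ (Prod.ext rfl ?_)
    change ε * (ε * p.down.2) = p.down.2
    rw [← mul_assoc, h2, one_mul]
  let f : kTimesObj.{v} ⟶ kTimesObj.{v} :=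
    { toHom := h
      surjective := fun p => ⟨h p, hh p⟩
      a₁ := 1
      a₂ := ε
      map_c₁ := fun s => by
        change ULift.up ((((s : AddCircle (2 * Real.pi)), (0 : ℝ)) : AddCircle (2 * Real.pi) × ℝ).1,
          ε * (((s : AddCircle (2 * Real.pi)), (0 : ℝ)) : AddCircle (2 * Real.pi) × ℝ).2) =
          ULift.up (((1 * s : ℝ) : AddCircle (2 * Real.pi)), (0 : ℝ))
        rw [mul_zero, one_mul]
      map_c₂ := fun t => by
        change ULift.up ((((0 : AddCircle (2 * Real.pi)), t) : AddCircle (2 * Real.pi) × ℝ).1,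
          ε * (((0 : AddCircle (2 * Real.pi)), t) : AddCircle (2 * Real.pi) × ℝ).2) =
          ULift.up ((0 : AddCircle (2 * Real.pi)), ε * t)
        rfl
      map_β := by
        change |ε| * (1 : ℝ) = 1 * |(1 : ℝ)|
        rw [real_sign_abs hε, abs_one] }
  exact ⟨TBPlus.isoMk f f hh hh, rfl, rfl⟩

/-- The parametrisation of `k∼(G)` is the identity of `ℝ × ℝ` (lifted): `A(s, t) = (s, t)`.
[cite: MochizukiAbsTopIII2015, Prop 5.8 (iv) p.140] -/
theorem kTildeObj_paramHom_apply (p : ℝ × ℝ) : kTildeObj.{v}.paramHom p = ULift.up p := by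
  rw [TBPlus.paramHom_apply]
  refine ULift.ext _ _ ?_
  change (p.1, (0 : ℝ)) + (0, p.2) = p
  rw [Prod.mk_add_mk, add_zero, zero_add]

end TMMono

/-! ## §2. The cochain-free components and their rescalings -/

namespace HolTFPair

variable {𝔄 : AutHolFieldFunctor.{u}}

/-- The constant function `1` is a family of signs. [folklore] -/
private theorem one_eq_one_or (𝔄 : AutHolFieldFunctor.{u}) : ∀ X : 𝔄.EA, (fun _ : 𝔄.EA => (1 : ℝ)) X = 1 ∨
    (fun _ : 𝔄.EA => (1 : ℝ)) X = -1 := fun _ => Or.inl rfl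

/-- **The `TB⊞`-leg of `λ⊞_pre(φ)` rescales `B′` by `ε_{φ_𝕏}`** (abc-iut-L4-t8's `Hom.sign` = the transition sign).
[cite: MochizukiAbsTopIII2015, Rmk 5.8.1 (i) p.142] -/
theorem a₁_toTBPlusMap_lamSimPlus_map {x y : HolTFPair 𝔄} (φ : x ⟶ y) :
    (HolTHPlusPair.toTBPlusMap (P := lamSimPlusObj x) (Q := lamSimPlusObj y) ((lamSimPlus 𝔄).map φ)).a₁ =
      AutHolFieldFunctor.transitionSign φ.base :=
  HolTHPlusPair.Hom.sign_eq_transitionSign _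

/-! ## §3. Naturality up to the sign automorphism — vertex `pre` -/

/-- ★★ **`η⊢_{v,pre}` is natural UP TO THE SIGN AUTOMORPHISM `(1, ε_φ)` of `k∼(G)`**, for every morphism `φ` of `TF`-pairs
and the cochain-free components `η⊢_𝕏 : b ↦ (σ_𝕏 Im e_𝕏 b, σ_𝕏 Re e_𝕏 b)`: `λ⊞_pre(φ)^{TB⊞} ≫ η⊢_𝕐 = η⊢_𝕏 ≫ k∼(G_φ) ≫ α_φ`.
Hence `η⊢_{v,pre}` is natural in print's `Orb(−)`-coarsified `𝒩⊢⊞_v`, with no orientation hypothesis.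
[cite: MochizukiAbsTopIII2015, Cor 5.10 (iv)(c) p.148] -/
theorem etaTilde_naturality_upToSign {x y : HolTFPair 𝔄} (φ : x ⟶ y) :
    ∃ α : TMMono.kTildeObj.{u + 1} ≅ TMMono.kTildeObj.{u + 1},
      α.hom.a₁ = 1 ∧ α.hom.a₂ = AutHolFieldFunctor.transitionSign φ.base ∧
      TBPlus.uliftHom.{u + 1} (HolTHPlusPair.toTBPlusMap (P := lamSimPlusObj x) (Q := lamSimPlusObj y)
          ((lamSimPlus 𝔄).map φ)) ≫ etaTildeApp (fun _ => (1 : ℝ)) y (one_eq_one_or 𝔄) =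
        etaTildeApp (fun _ => (1 : ℝ)) x (one_eq_one_or 𝔄) ≫ TMMono.kTildeMap.{u + 1} (𝔄.toTMMono.map φ.base) ≫
          α.hom := by
  obtain ⟨α, h₁, h₂⟩ := TMMono.exists_kTildeObj_signIso.{u + 1} (AutHolFieldFunctor.transitionSign φ.base)
    (AutHolFieldFunctor.transitionSign_eq_one_or φ.base)
  refine ⟨α, h₁, h₂, TBPlus.hom_ext_paramHom fun p => ?_⟩
  rw [TBPlus.toHom_paramHom, TBPlus.toHom_paramHom, TBPlus.comp_a₁, TBPlus.comp_a₂, TBPlus.comp_a₁, TBPlus.comp_a₂,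
    TBPlus.comp_a₁, TBPlus.comp_a₂]
  simp only [TBPlus.diag_apply, TBPlus.uliftHom_a₁, TBPlus.uliftHom_a₂, a₁_toTBPlusMap_lamSimPlus_map,
    HolTHPlusPair.toTBPlusMap_a₂, etaTildeApp_a₁, etaTildeApp_a₂, TMMono.kTildeMap_a₁, TMMono.kTildeMap_a₂, h₁, h₂,
    𝔄.sign_toTMMono_map_eq, one_mul, mul_one]
  rcases 𝔄.chartSign_eq_one_or x.X with h | h <;>
    rcases AutHolFieldFunctor.transitionSign_eq_one_or φ.base with h' | h' <;>
      simp only [h, h', one_mul, mul_one, neg_mul, mul_neg, neg_neg]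

/-- **On the nose when `ε_φ = 1`** (orientation-preserving `φ`): the square commutes without correction.
[cite: MochizukiAbsTopIII2015, Cor 5.10 (iv)(c) p.148] -/
theorem etaTilde_naturality_of_transitionSign_eq_one {x y : HolTFPair 𝔄} (φ : x ⟶ y)
    (hφ : AutHolFieldFunctor.transitionSign φ.base = 1) :
    TBPlus.uliftHom.{u + 1} (HolTHPlusPair.toTBPlusMap (P := lamSimPlusObj x) (Q := lamSimPlusObj y)
        ((lamSimPlus 𝔄).map φ)) ≫ etaTildeApp (fun _ => (1 : ℝ)) y (one_eq_one_or 𝔄) =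
      etaTildeApp (fun _ => (1 : ℝ)) x (one_eq_one_or 𝔄) ≫ TMMono.kTildeMap.{u + 1} (𝔄.toTMMono.map φ.base) := by
  refine TBPlus.hom_ext_paramHom fun p => ?_
  rw [TBPlus.toHom_paramHom, TBPlus.toHom_paramHom, TBPlus.comp_a₁, TBPlus.comp_a₂, TBPlus.comp_a₁, TBPlus.comp_a₂]
  simp only [TBPlus.diag_apply, TBPlus.uliftHom_a₁, TBPlus.uliftHom_a₂, a₁_toTBPlusMap_lamSimPlus_map,
    HolTHPlusPair.toTBPlusMap_a₂, etaTildeApp_a₁, etaTildeApp_a₂, TMMono.kTildeMap_a₁, TMMono.kTildeMap_a₂, hφ,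
    𝔄.sign_toTMMono_map_eq, one_mul, mul_one]
  rcases 𝔄.chartSign_eq_one_or x.X with h | h <;> simp only [h, one_mul, mul_one, neg_mul, mul_neg, neg_neg]

/-! ## §4. Naturality up to the sign automorphism — vertex `mult` -/

/-- ★★ **`η⊢_{v,mult}` is natural UP TO THE SIGN AUTOMORPHISM `(1, ε_φ)` of `k×(G)`** (cochain-free components
`etaTimesIso (fun _ => 1)`): `λ⊞_mult(φ)^{TB⊞} ≫ η⊢_𝕐 = η⊢_𝕏 ≫ k×(G_φ) ≫ α_φ`. [cite: MochizukiAbsTopIII2015, Cor 5.10 (iv)(c) p.148] -/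
theorem etaTimes_naturality_upToSign {x y : HolTFPair 𝔄} (φ : x ⟶ y) :
    ∃ α : TMMono.kTimesObj.{u + 1} ≅ TMMono.kTimesObj.{u + 1},
      α.hom.a₁ = 1 ∧ α.hom.a₂ = AutHolFieldFunctor.transitionSign φ.base ∧
      TBPlus.uliftHom.{u + 1} (HolTHPlusPair.toTBPlusMap (P := lamTimesPlusObj x) (Q := lamTimesPlusObj y)
          ((lamTimesPlus 𝔄).map φ)) ≫ (etaTimesIso (fun _ => (1 : ℝ)) y (one_eq_one_or 𝔄)).hom =
        (etaTimesIso (fun _ => (1 : ℝ)) x (one_eq_one_or 𝔄)).hom ≫ TMMono.kTimesMap.{u + 1} (𝔄.toTMMono.map φ.base) ≫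
          α.hom := by
  obtain ⟨α, h₁, h₂⟩ := TMMono.exists_kTimesObj_signIso.{u + 1} (AutHolFieldFunctor.transitionSign φ.base)
    (AutHolFieldFunctor.transitionSign_eq_one_or φ.base)
  refine ⟨α, h₁, h₂, TBPlus.hom_ext_paramHom fun p => ?_⟩
  rw [TBPlus.toHom_paramHom, TBPlus.toHom_paramHom, TBPlus.comp_a₁, TBPlus.comp_a₂, TBPlus.comp_a₁, TBPlus.comp_a₂,
    TBPlus.comp_a₁, TBPlus.comp_a₂]
  simp only [TBPlus.diag_apply, TBPlus.uliftHom_a₁, TBPlus.uliftHom_a₂, a₁_toTBPlusMap_lamTimesPlus_map,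
    HolTHPlusPair.toTBPlusMap_a₂, etaTimesIso_hom_a₁, etaTimesIso_hom_a₂, TMMono.kTimesMap_a₁, TMMono.kTimesMap_a₂,
    h₁, h₂, 𝔄.sign_toTMMono_map_eq, one_mul, mul_one]
  rcases 𝔄.chartSign_eq_one_or x.X with h | h <;>
    rcases AutHolFieldFunctor.transitionSign_eq_one_or φ.base with h' | h' <;>
      simp only [h, h', one_mul, mul_one, neg_mul, mul_neg, neg_neg]

end HolTFPair

end Literature.AnabelianGeometry.AbsoluteAnabelian
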